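import Summits.QuantumFields.YangMills.Theorems.LuscherReductionRunningReductionExplicitNoIntruderDefs
import Summits.QuantumFields.YangMills.Theorems.LuscherReductionOneSiteLevelsVariational
import Summits.QuantumFields.YangMills.Theorems.FemtoTransferGapSlabRayleigh
import HarnessLib

/-!
# Crux RED `RunningReduction`, line «KTR» rev 3 part 4 «EXPLICIT»: transfer-moment calculus, the glue of the fifth stub onto KT's stub 3,
# and the degenerate instance `ExplicitNoIntruder 0`

Support module (fleet service by seat ym-infvol-p2; owner ym-beyond-p1 g17 STAFFING ASK (δ), ym-fleet bus 2026-08-27T04:01:33Z) for crux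
`RunningReduction` (route `LuscherReduction`, item stmt-QuantumFields-19978), line «KTR» rev 3 (`pub/ym-beyond/p1-g17-files/Lines-KTR-r3.lean`
sha16 04b54eb2275f0fa2, memo `OWNER-MEMO-3a-g17.md`), stated over the TREE constants of `LuscherReductionRunningReductionExplicitNoIntruderDefs`.
* §1 Transfer-moment calculus at fixed lattice for the positive symmetric `K_β` (`β ≥ 0`) on physical test functions, `a_j = ⟨ψ, K_β^j ψ⟩`:
  `a_{2m} = ‖K^mψ‖²`; Cauchy–Schwarz log-convexity `a_m² ≤ a_0 a_{2m}` and the full form `a_{j+1}² ≤ a_j a_{j+2}`; the RATIO LAW `a_{j+1} ≤ λ_0 a_j`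
  (even `j`: a Rayleigh quotient; odd `j`: log-convexity + the even case), hence `a_n ≤ λ_0^n a_0`, `0 ≤ a_j`; the dyadic conversion
  `a_1^{2^p} ≤ a_0^{2^p−1} a_{2^p}`.  No spectral theorem — only the PSD Cauchy–Schwarz inequalities of `FemtoTransferGapSlabRayleigh` and the
  Rayleigh bound `qform_le_levelValue_zero_mul`.
* §2 THE GLUE (memo §2, skeleton `KT.coarseNoIntruder_of_explicit`, re-proved over tree constants and for ARBITRARY physical constraint families):
  `levelValue_le_of_longTime k`, `levelValue_le_of_explicitNoIntruder k : ExplicitNoIntruder k → (KT's stub 3 at level k)`,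
  `coarseNoIntruder_of_explicit : (∀ k, ExplicitNoIntruder k) → (∀ k, …)` — conclusions = the VERBATIM body of `KT.CoarseNoIntruder`
  (= `KTCoarseHandover.KTCoarseNoIntruder` = `KT.Derived.coarseNoIntruder`), so `Derived.coarseNoIntruder` follows by `exact`.
* §3 THE DEGENERATE INSTANCE (memo §5, now kernel-checked): `explicitNoIntruder_zero : ExplicitNoIntruder 0` UNCONDITIONALLY (`Δ_0 = 0`, ratio law).
* The SEAM of memo §2b (stub 3 at `k = 1` + `0 < ε₁` ⟹ `FemtoGapSU2`) is the companion file `LuscherReductionFemtoGapSU2OfNoIntruder`.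

HONEST FRAMING: femto rung R2b1 (`FemtoGapOfRecord`), fixed-lattice functional analysis and bookkeeping; `ExplicitNoIntruder k` for `k ≥ 1` (the XL
content: effective toron dynamics ∕ asymptotic freedom uniformly in `L`) is untouched; nothing here bears on infinite volume or the Clay gap.
References: [cite: Luscher1983]; [cite: LuscherMunster1984]; M. Reed, B. Simon IV (1978) XIII.1 [cite: ReedSimonIV1978].
-/
set_option autoImplicit false

noncomputable section

open MeasureTheory Filter Topology Real
open Literature.MathematicalPhysics.QuantumFieldTheory
open Literature.MathematicalPhysics.QuantumLattice
open Literature.Analysis.OperatorTheory.YMMatrixModel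

namespace Summit.QuantumFields.YangMills.Theorems.FemtoTransferGap

/-! ## §1 Transfer-moment calculus -/

section Moments

variable {L : ℕ} [NeZero L]

/-- `a_0 = ‖ψ‖²`. [folklore] -/
theorem transferMoment_zero (β : ℝ) (ψ : GaugeConfig 3 L SU2 → ℝ) : transferMoment β ψ 0 = l2 ψ ψ := rfl

/-- `a_1 = ⟨ψ, K_β ψ⟩`. [folklore] -/
theorem transferMoment_one (β : ℝ) (ψ : GaugeConfig 3 L SU2 → ℝ) : transferMoment β ψ 1 = qform su2Rep β ψ ψ := by
  rw [transferMoment, Function.iterate_one, qform_eq_l2_transferApply]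

/-- `a_{i+j} = ⟨K^i ψ, K^j ψ⟩` (symmetry of `K_β` on physical test functions). [cite: ReedSimonIV1978, XIII.1] -/
theorem transferMoment_add (β : ℝ) {ψ : GaugeConfig 3 L SU2 → ℝ} (hψ : IsPhys ψ) (i j : ℕ) :
    transferMoment β ψ (i + j) = l2 ((transferApply (L := L) β)^[i] ψ) ((transferApply β)^[j] ψ) := by
  rw [transferMoment, l2_iterate_iterate β hψ i j]

/-- `a_{2m} = ‖K^m ψ‖²`. [folklore] -/
theorem transferMoment_two_mul (β : ℝ) {ψ : GaugeConfig 3 L SU2 → ℝ} (hψ : IsPhys ψ) (m : ℕ) :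
    transferMoment β ψ (2 * m) = l2 ((transferApply (L := L) β)^[m] ψ) ((transferApply β)^[m] ψ) := by
  rw [two_mul, transferMoment_add β hψ]

/-- `a_{2m+1} = ⟨K^mψ, K_β K^mψ⟩` — the transfer form of the iterate. [folklore] -/
theorem transferMoment_two_mul_succ (β : ℝ) {ψ : GaugeConfig 3 L SU2 → ℝ} (hψ : IsPhys ψ) (m : ℕ) :
    transferMoment β ψ (2 * m + 1) =
      qform su2Rep β ((transferApply (L := L) β)^[m] ψ) ((transferApply β)^[m] ψ) := by
  rw [show 2 * m + 1 = m + (m + 1) by ring, transferMoment_add β hψ, Function.iterate_succ_apply',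
    qform_eq_l2_transferApply]

/-- **Log-convexity by Cauchy–Schwarz**: `a_m² ≤ a_0 · a_{2m}`. [cite: ReedSimonIV1978, XIII.1] -/
theorem transferMoment_sq_le (β : ℝ) {ψ : GaugeConfig 3 L SU2 → ℝ} (hψ : IsPhys ψ) (m : ℕ) :
    transferMoment β ψ m ^ 2 ≤ transferMoment β ψ 0 * transferMoment β ψ (2 * m) := by
  have hKm : IsPhys ((transferApply (L := L) β)^[m] ψ) := isPhys_iterate_transferApply β hψ m
  rw [transferMoment_zero, transferMoment_two_mul β hψ m]
  exact sq_l2_le hψ hKm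

/-- **Full log-convexity**: `a_{j+1}² ≤ a_j · a_{j+2}` for `β ≥ 0` — even `j = 2s`: `L²` Cauchy–Schwarz for `⟨K^sψ, K^{s+1}ψ⟩`; odd `j = 2s+1`:
Cauchy–Schwarz for the positive semi-definite transfer form, `⟨K^sψ, K_β K^{s+1}ψ⟩² ≤ ⟨K^sψ,K_βK^sψ⟩⟨K^{s+1}ψ,K_βK^{s+1}ψ⟩`.  Hence the ratios
`a_{j+1}/a_j` are non-decreasing in `j`. [cite: ReedSimonIV1978, XIII.1] -/
theorem transferMoment_succ_sq_le {β : ℝ} (hβ : 0 ≤ β) {ψ : GaugeConfig 3 L SU2 → ℝ} (hψ : IsPhys ψ) (j : ℕ) :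
    transferMoment β ψ (j + 1) ^ 2 ≤ transferMoment β ψ j * transferMoment β ψ (j + 2) := by
  obtain ⟨s, rfl | rfl⟩ := Nat.even_or_odd' j
  · -- `j = 2s`: `a_{2s+1} = ⟨K^sψ, K^{s+1}ψ⟩`, `a_{2s} = ‖K^sψ‖²`, `a_{2s+2} = ‖K^{s+1}ψ‖²`
    have hs : IsPhys ((transferApply (L := L) β)^[s] ψ) := isPhys_iterate_transferApply β hψ s
    have hs1 : IsPhys ((transferApply (L := L) β)^[s + 1] ψ) := isPhys_iterate_transferApply β hψ (s + 1)
    have e1 : transferMoment β ψ (2 * s + 1) = l2 ((transferApply (L := L) β)^[s] ψ) ((transferApply β)^[s + 1] ψ) := by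
      rw [show 2 * s + 1 = s + (s + 1) by ring, transferMoment_add β hψ]
    have e0 : transferMoment β ψ (2 * s) = l2 ((transferApply (L := L) β)^[s] ψ) ((transferApply β)^[s] ψ) :=
      transferMoment_two_mul β hψ s
    have e2 : transferMoment β ψ (2 * s + 2) = l2 ((transferApply (L := L) β)^[s + 1] ψ) ((transferApply β)^[s + 1] ψ) := by
      rw [show 2 * s + 2 = 2 * (s + 1) by ring, transferMoment_two_mul β hψ]
    rw [e1, e0, e2]
    exact sq_l2_le hs hs1
  · -- `j = 2s+1`: `a_{2s+2} = ⟨K^sψ, K_β K^{s+1}ψ⟩`, `a_{2s+1} = ⟨K^sψ,K_βK^sψ⟩`, `a_{2s+3} = ⟨K^{s+1}ψ,K_βK^{s+1}ψ⟩`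
    have hs : IsPhys ((transferApply (L := L) β)^[s] ψ) := isPhys_iterate_transferApply β hψ s
    have hs1 : IsPhys ((transferApply (L := L) β)^[s + 1] ψ) := isPhys_iterate_transferApply β hψ (s + 1)
    have e1 : transferMoment β ψ (2 * s + 1 + 1) =
        qform su2Rep β ((transferApply (L := L) β)^[s] ψ) ((transferApply β)^[s + 1] ψ) := by
      rw [show 2 * s + 1 + 1 = s + (s + 1 + 1) by ring, transferMoment_add β hψ, Function.iterate_succ_apply',
        qform_eq_l2_transferApply]
    have e0 : transferMoment β ψ (2 * s + 1) =
        qform su2Rep β ((transferApply (L := L) β)^[s] ψ) ((transferApply β)^[s] ψ) := transferMoment_two_mul_succ β hψ s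
    have e2 : transferMoment β ψ (2 * s + 1 + 2) =
        qform su2Rep β ((transferApply (L := L) β)^[s + 1] ψ) ((transferApply β)^[s + 1] ψ) := by
      rw [show 2 * s + 1 + 2 = 2 * (s + 1) + 1 by ring, transferMoment_two_mul_succ β hψ]
    rw [e1, e0, e2]
    exact sq_qform_le hβ hs hs1

/-- `0 ≤ a_j` for `β ≥ 0` (even `j`: a norm; odd `j`: the PSD transfer form of an iterate). [cite: ReedSimonIV1978, XIII.1] -/
theorem transferMoment_nonneg {β : ℝ} (hβ : 0 ≤ β) {ψ : GaugeConfig 3 L SU2 → ℝ} (hψ : IsPhys ψ) (j : ℕ) :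
    0 ≤ transferMoment β ψ j := by
  obtain ⟨s, rfl | rfl⟩ := Nat.even_or_odd' j
  · rw [transferMoment_two_mul β hψ]; exact l2_self_nonneg _
  · rw [transferMoment_two_mul_succ β hψ]; exact qform_su2Rep_self_nonneg hβ (isPhys_iterate_transferApply β hψ s)

/-- The even step of the ratio law: `a_{2s+1} ≤ λ_0 · a_{2s}` — the Rayleigh quotient of the physical iterate `K^sψ` is at most `λ_0`
(and `a_{2s+1} = 0` when `‖K^sψ‖ = 0`, by Cauchy–Schwarz). [cite: ReedSimonIV1978, Thm. XIII.1] -/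
theorem transferMoment_two_mul_succ_le (β : ℝ) {ψ : GaugeConfig 3 L SU2 → ℝ} (hψ : IsPhys ψ) (s : ℕ) :
    transferMoment β ψ (2 * s + 1) ≤ levelValue su2Rep L β 0 * transferMoment β ψ (2 * s) := by
  have hs : IsPhys ((transferApply (L := L) β)^[s] ψ) := isPhys_iterate_transferApply β hψ s
  rw [transferMoment_two_mul_succ β hψ, transferMoment_two_mul β hψ]
  set φ := (transferApply (L := L) β)^[s] ψ with hφ
  rcases (l2_self_nonneg φ).eq_or_lt with h0 | hpos
  · -- `‖φ‖² = 0`: then `⟨φ, K φ⟩ = 0`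
    have hcs := sq_l2_le hs (isPhys_transferApply β hs)
    rw [← h0, zero_mul] at hcs
    have hq : qform su2Rep β φ φ = 0 := by
      rw [qform_eq_l2_transferApply]; exact pow_eq_zero_iff (n := 2) (by norm_num) |>.mp (le_antisymm hcs (sq_nonneg _))
    rw [hq, ← h0, mul_zero]
  · exact qform_le_levelValue_zero_mul su2Rep continuous_su2Rep β hs hpos

/-- **The ratio law**: `a_{j+1} ≤ λ_0 · a_j` for every `j` (`β ≥ 0`, physical `ψ`).  Even `j`: `transferMoment_two_mul_succ_le`; odd `j = 2s+1`:
log-convexity `a_{2s+2}² ≤ a_{2s+1} a_{2s+3}` and the even case `a_{2s+3} ≤ λ_0 a_{2s+2}` give `a_{2s+2}² ≤ λ_0 a_{2s+1} a_{2s+2}`.  (The operator-norm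
statement `‖K_βφ‖ ≤ λ_0‖φ‖` on physical `φ`, proved with Rayleigh quotients only.) [cite: ReedSimonIV1978, Thm. XIII.1] -/
theorem transferMoment_succ_le {β : ℝ} (hβ : 0 ≤ β) {ψ : GaugeConfig 3 L SU2 → ℝ} (hψ : IsPhys ψ) (j : ℕ) :
    transferMoment β ψ (j + 1) ≤ levelValue su2Rep L β 0 * transferMoment β ψ j := by
  obtain ⟨s, rfl | rfl⟩ := Nat.even_or_odd' j
  · exact transferMoment_two_mul_succ_le β hψ s
  · have hconv := transferMoment_succ_sq_le hβ hψ (2 * s + 1)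
    have heven : transferMoment β ψ (2 * s + 1 + 2) ≤ levelValue su2Rep L β 0 * transferMoment β ψ (2 * s + 1 + 1) := by
      have := transferMoment_two_mul_succ_le β hψ (s + 1)
      convert this using 2 <;> ring_nf
    have ha1 : 0 ≤ transferMoment β ψ (2 * s + 1) := transferMoment_nonneg hβ hψ _
    have ha2 : 0 ≤ transferMoment β ψ (2 * s + 1 + 1) := transferMoment_nonneg hβ hψ _
    set x := transferMoment β ψ (2 * s + 1)
    set y := transferMoment β ψ (2 * s + 1 + 1)
    set z := transferMoment β ψ (2 * s + 1 + 2)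
    -- `y² ≤ x z ≤ x λ y`
    have hyy : y ^ 2 ≤ levelValue su2Rep L β 0 * x * y := by
      calc y ^ 2 ≤ x * z := hconv
        _ ≤ x * (levelValue su2Rep L β 0 * y) := mul_le_mul_of_nonneg_left heven ha1
        _ = levelValue su2Rep L β 0 * x * y := by ring
    rcases ha2.eq_or_lt with hy0 | hypos
    · rw [← hy0]; exact mul_nonneg (levelValue_zero_su2Rep_pos L β).le ha1
    · exact le_of_mul_le_mul_right (by rw [sq] at hyy; linarith [hyy]) hypos

/-- **`a_n ≤ λ_0^n · a_0`**: the long-time vacuum-normalised moment bound with NO constraint (iterate the ratio law). [cite: ReedSimonIV1978, Thm. XIII.1] -/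
theorem transferMoment_le_pow_mul {β : ℝ} (hβ : 0 ≤ β) {ψ : GaugeConfig 3 L SU2 → ℝ} (hψ : IsPhys ψ) (n : ℕ) :
    transferMoment β ψ n ≤ levelValue su2Rep L β 0 ^ n * transferMoment β ψ 0 := by
  have hlv : 0 ≤ levelValue su2Rep L β 0 := (levelValue_zero_su2Rep_pos L β).le
  induction n with
  | zero => simp
  | succ n ih =>
    calc transferMoment β ψ (n + 1) ≤ levelValue su2Rep L β 0 * transferMoment β ψ n := transferMoment_succ_le hβ hψ n
      _ ≤ levelValue su2Rep L β 0 * (levelValue su2Rep L β 0 ^ n * transferMoment β ψ 0) := mul_le_mul_of_nonneg_left ih hlv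
      _ = levelValue su2Rep L β 0 ^ (n + 1) * transferMoment β ψ 0 := by ring

/-- **Unit time → dyadic long time**: `a_1^{2^p} ≤ a_0^{2^p − 1} · a_{2^p}` (`β ≥ 0`). [cite: ReedSimonIV1978, XIII.1] -/
theorem transferMoment_one_pow_le {β : ℝ} (hβ : 0 ≤ β) {ψ : GaugeConfig 3 L SU2 → ℝ} (hψ : IsPhys ψ) (p : ℕ) :
    transferMoment β ψ 1 ^ (2 ^ p) ≤ transferMoment β ψ 0 ^ (2 ^ p - 1) * transferMoment β ψ (2 ^ p) := by
  have ha0 : 0 ≤ transferMoment β ψ 0 := by rw [transferMoment_zero]; exact l2_self_nonneg _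
  have ha1 : 0 ≤ transferMoment β ψ 1 := transferMoment_nonneg hβ hψ 1
  induction p with
  | zero => simp
  | succ p ih =>
    have hcs : transferMoment β ψ (2 ^ p) ^ 2 ≤ transferMoment β ψ 0 * transferMoment β ψ (2 ^ (p + 1)) := by
      have := transferMoment_sq_le β hψ (2 ^ p)
      rwa [← pow_succ'] at this
    have hl : 0 ≤ transferMoment β ψ 1 ^ (2 ^ p) := pow_nonneg ha1 _
    have hpow : 2 ^ (p + 1) = 2 * 2 ^ p := by ring
    calc transferMoment β ψ 1 ^ (2 ^ (p + 1))
        = (transferMoment β ψ 1 ^ (2 ^ p)) ^ 2 := by rw [hpow, pow_mul']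
      _ ≤ (transferMoment β ψ 0 ^ (2 ^ p - 1) * transferMoment β ψ (2 ^ p)) ^ 2 := pow_le_pow_left₀ hl ih 2
      _ = transferMoment β ψ 0 ^ (2 * (2 ^ p - 1)) * transferMoment β ψ (2 ^ p) ^ 2 := by ring
      _ ≤ transferMoment β ψ 0 ^ (2 * (2 ^ p - 1)) * (transferMoment β ψ 0 * transferMoment β ψ (2 ^ (p + 1))) :=
          mul_le_mul_of_nonneg_left hcs (pow_nonneg ha0 _)
      _ = transferMoment β ψ 0 ^ (2 * (2 ^ p - 1) + 1) * transferMoment β ψ (2 ^ (p + 1)) := by ring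
      _ = transferMoment β ψ 0 ^ (2 ^ (p + 1) - 1) * transferMoment β ψ (2 ^ (p + 1)) := by
          have h1 : 1 ≤ 2 ^ p := Nat.one_le_two_pow
          congr 2
          omega

/-- A power of two in the window `(X, 2X]`, `X ≥ 1`. [folklore] -/
theorem exists_two_pow_mem_window {X : ℝ} (hX : 1 ≤ X) : ∃ p : ℕ, X < (2 : ℝ) ^ (p + 1) ∧ (2 : ℝ) ^ (p + 1) ≤ 2 * X := by
  obtain ⟨p, hp, hp'⟩ := exists_nat_pow_near hX one_lt_two
  exact ⟨p, hp', by rw [pow_succ]; linarith⟩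

end Moments

/-! ## §2 The glue: a long-time no-intruder bound with `k` physical constraints ⟹ KT's stub 3 at level `k` -/

/-- **The long-time door (PROVED), for ARBITRARY physical constraint families.**  Suppose that for every `ε > 0` there are a physical-time scale
`M > 0` and a window threshold such that, eventually in the femto window, SOME `k` physical constraint states `φ_0 … φ_{k−1}` satisfy: every physical
`ψ ⊥ φ_i` has `⟨ψ, K_β^n ψ⟩ ≤ e^{−(Δ_k − ε)·nλ/L} λ_0^n ‖ψ‖²` for all `n` with `nλ/L ∈ [M, 2M]`.  Then Lüscher's law from below holds at level `k` with
relative error `o(1)` — the VERBATIM body of KT's stub 3 `KT.CoarseNoIntruder` at `k`.  Given `d < Δ_k` (for `d < 0` use `λ_k ≤ λ_0`), take `ε = (Δ_k − d)/2`,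
shrink `lam0 ≤ M/2` so that `X = M·L/λ ≥ 1`, pick the dyadic long time `n = 2^{p+1} ∈ (X, 2X]` (so `nλ/L ∈ (M, 2M]`); the «inf–sup ≤» door
`levelValue_le_of_forall_rayleigh_le` with the `k` constraints reduces `λ_k ≤ e^{−dλ/L}λ_0` to `a_1 ≤ e^{−dλ/L} λ_0 a_0` for physical `ψ ⊥` constraints, and
`a_1^n ≤ a_0^{n−1} a_n ≤ a_0^{n−1}·(e^{−(Δ_k−ε)λ/L} λ_0)^n a_0` gives it by the `n`-th root.  (The naming of the constraints is NOT used: this is the content-free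
half of the owner's costume test d4, memo §1.) [cite: ReedSimonIV1978, XIII.1] [cite: Luscher1983] -/
theorem levelValue_le_of_longTime (k : ℕ)
    (h : ∀ ε : ℝ, 0 < ε → ∃ M : ℝ, 0 < M ∧ ∃ lam0 : ℝ, 0 < lam0 ∧ ∀ lam : ℝ, 0 < lam → lam ≤ lam0 →
      ∃ L1 : ℕ, ∀ (L : ℕ) [NeZero L], L1 ≤ L → ∀ β : ℝ, InFemtoWindow lam β L →
        ∃ φs : Fin k → (GaugeConfig 3 L SU2 → ℝ), (∀ i, IsPhys (φs i)) ∧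
          ∀ n : ℕ, M ≤ n * luscherLambda β L / L → n * luscherLambda β L / L ≤ 2 * M →
            ∀ ψ : GaugeConfig 3 L SU2 → ℝ, IsPhys ψ → (∀ i, l2 ψ (φs i) = 0) →
              l2 ψ ((transferApply β)^[n] ψ) ≤
                Real.exp (-((levelGap k - ε) * (n * luscherLambda β L / L))) * levelValue su2Rep L β 0 ^ n * l2 ψ ψ) :
    ∀ d : ℝ, d < levelGap k → ∃ lam0 : ℝ, 0 < lam0 ∧ ∀ lam : ℝ, 0 < lam → lam ≤ lam0 →
      ∃ L0 : ℕ, ∀ (L : ℕ) [NeZero L], L0 ≤ L → ∀ β : ℝ, InFemtoWindow lam β L →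
        levelValue su2Rep L β k ≤ Real.exp (-(d * luscherLambda β L) / L) * levelValue su2Rep L β 0 := by
  intro d hd
  -- the case `d < 0` is trivial: `λ_k ≤ λ_0 ≤ e^{-dλ/L} λ_0`
  by_cases hd0 : d < 0
  · refine ⟨1, one_pos, fun lam hlam _ => ⟨0, fun L _ _ β hw => ?_⟩⟩
    have hl : 0 < luscherLambda β L := luscherLambda_pos_of_window hlam hw
    have hL : (0 : ℝ) < L := Nat.cast_pos.mpr (Nat.pos_of_ne_zero (NeZero.ne L))
    have hexp : 1 ≤ Real.exp (-(d * luscherLambda β L) / L) := by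
      rw [Real.one_le_exp_iff]
      have : d * luscherLambda β L ≤ 0 := by nlinarith
      exact div_nonneg (by linarith) hL.le
    have h0 : 0 < levelValue su2Rep L β 0 := levelValue_zero_su2Rep_pos L β
    calc levelValue su2Rep L β k ≤ levelValue su2Rep L β 0 := by
          rw [levelValue_zero]; exact levelValue_su2Rep_le_topValue L β k
      _ = 1 * levelValue su2Rep L β 0 := (one_mul _).symm
      _ ≤ Real.exp (-(d * luscherLambda β L) / L) * levelValue su2Rep L β 0 := mul_le_mul_of_nonneg_right hexp h0.le
  push Not at hd0
  set ε : ℝ := (levelGap k - d) / 2 with hε_def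
  have hε : 0 < ε := by rw [hε_def]; linarith
  have hdε : d ≤ levelGap k - ε := by rw [hε_def]; linarith
  obtain ⟨M, hM, lam0, hlam0, H⟩ := h ε hε
  refine ⟨min lam0 (M / 2), lt_min hlam0 (by linarith), ?_⟩
  intro lam hlam hle
  have hle0 : lam ≤ lam0 := hle.trans (min_le_left _ _)
  have hleM : lam ≤ M / 2 := hle.trans (min_le_right _ _)
  obtain ⟨L1, HL⟩ := H lam hlam hle0
  refine ⟨L1, ?_⟩
  intro L _ hL1 β hw
  obtain ⟨φs, hC, Hn⟩ := HL L hL1 β hw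
  have hβ0 : 0 ≤ β := zero_le_one.trans hw.1
  set l : ℝ := luscherLambda β L with hl_def
  have hl : 0 < l := luscherLambda_pos_of_window hlam hw
  have hl2 : l ≤ 2 * lam := hw.2.2
  have hL : (0 : ℝ) < L := Nat.cast_pos.mpr (Nat.pos_of_ne_zero (NeZero.ne L))
  have hL1' : (1 : ℝ) ≤ L := by exact_mod_cast Nat.one_le_iff_ne_zero.mpr (NeZero.ne L)
  -- the dyadic long time `n = 2^(p+1) ∈ (X, 2X]`, `X = M L / l ≥ 1`
  set X : ℝ := M * L / l with hX_def
  have hX1 : 1 ≤ X := by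
    rw [hX_def, le_div_iff₀ hl]
    nlinarith
  obtain ⟨p, hpX, hp2X⟩ := exists_two_pow_mem_window hX1
  set n : ℕ := 2 ^ (p + 1) with hn_def
  have hn_cast : (n : ℝ) = (2 : ℝ) ^ (p + 1) := by rw [hn_def]; push_cast; ring
  have hn0 : n ≠ 0 := by positivity
  have htime_lo : M ≤ n * l / L := by
    rw [hn_cast, le_div_iff₀ hL]
    have : M * L = X * l := by rw [hX_def]; field_simp
    rw [this]
    exact (mul_le_mul_of_nonneg_right hpX.le hl.le)
  have htime_hi : n * l / L ≤ 2 * M := by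
    rw [hn_cast, div_le_iff₀ hL]
    have : 2 * M * L = 2 * X * l := by rw [hX_def]; field_simp
    rw [this]
    exact mul_le_mul_of_nonneg_right hp2X hl.le
  -- the «inf–sup ≤» door with the explicit constraints
  have hs0 : 0 ≤ Real.exp (-(d * l) / L) * levelValue su2Rep L β 0 :=
    mul_nonneg (Real.exp_pos _).le (levelValue_zero_su2Rep_pos L β).le
  refine levelValue_le_of_forall_rayleigh_le su2Rep β hs0 φs hC ?_
  intro ψ hψ hperp hpos
  have key := Hn n htime_lo htime_hi ψ hψ hperp
  -- abbreviations
  set a0 := transferMoment β ψ 0 with ha0_def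
  set a1 := transferMoment β ψ 1 with ha1_def
  set an := transferMoment β ψ n with han_def
  have ha0 : 0 < a0 := by rw [ha0_def, transferMoment_zero]; exact hpos
  have ha1 : 0 ≤ a1 := transferMoment_nonneg hβ0 hψ 1
  have hlv0 : 0 < levelValue su2Rep L β 0 := levelValue_zero_su2Rep_pos L β
  -- the hypothesis in moment form, with the exponential as an `n`-th power
  set E : ℝ := Real.exp (-((levelGap k - ε) * l / L)) with hE_def
  have hE : 0 < E := Real.exp_pos _
  have hexpn : Real.exp (-((levelGap k - ε) * (n * l / L))) = E ^ n := by
    rw [hE_def, ← Real.exp_nat_mul]; congr 1; field_simp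
  have key' : an ≤ E ^ n * levelValue su2Rep L β 0 ^ n * a0 := by
    rw [han_def, ha0_def, transferMoment, transferMoment_zero, ← hexpn]; exact key
  -- `a_1^n ≤ a_0^{n-1} a_n ≤ (E λ_0 a_0)^n`
  have hconv : a1 ^ n ≤ a0 ^ (n - 1) * an := by
    rw [ha1_def, ha0_def, han_def, hn_def]; exact transferMoment_one_pow_le hβ0 hψ (p + 1)
  have hchain : a1 ^ n ≤ (E * levelValue su2Rep L β 0 * a0) ^ n := by
    calc a1 ^ n ≤ a0 ^ (n - 1) * an := hconv
      _ ≤ a0 ^ (n - 1) * (E ^ n * levelValue su2Rep L β 0 ^ n * a0) :=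
          mul_le_mul_of_nonneg_left key' (pow_nonneg ha0.le _)
      _ = (E * levelValue su2Rep L β 0) ^ n * (a0 ^ (n - 1) * a0) := by ring
      _ = (E * levelValue su2Rep L β 0) ^ n * a0 ^ n := by
          congr 1
          rw [← pow_succ]
          congr 1
          have : 1 ≤ n := Nat.one_le_iff_ne_zero.mpr hn0
          omega
      _ = (E * levelValue su2Rep L β 0 * a0) ^ n := by ring
  have hroot : a1 ≤ E * levelValue su2Rep L β 0 * a0 :=
    (pow_le_pow_iff_left₀ ha1 (by positivity) hn0).mp hchain
  -- `E ≤ e^{-dλ/L}` since `d ≤ Δ_k − ε`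
  have hEd : E ≤ Real.exp (-(d * l) / L) := by
    rw [hE_def, Real.exp_le_exp, neg_div, neg_le_neg_iff, div_le_div_iff_of_pos_right hL]
    exact mul_le_mul_of_nonneg_right hdε hl.le
  calc qform su2Rep β ψ ψ = a1 := by rw [ha1_def, transferMoment_one]
    _ ≤ E * levelValue su2Rep L β 0 * a0 := hroot
    _ ≤ Real.exp (-(d * l) / L) * levelValue su2Rep L β 0 * a0 :=
        mul_le_mul_of_nonneg_right (mul_le_mul_of_nonneg_right hEd hlv0.le) ha0.le
    _ = Real.exp (-(d * l) / L) * levelValue su2Rep L β 0 * l2 ψ ψ := by rw [ha0_def, transferMoment_zero]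

/-- **Glue (PROVED): `ExplicitNoIntruder k` ⟹ Lüscher's law from below at level `k` with relative error `o(1)`** — the VERBATIM body of KT's stub 3
`KT.CoarseNoIntruder` at `k` (no coarse lattice): the long-time door with the EXPLICIT constraints `J_{t,m} u_i = dressedLift β t m (u i)`.
(Memo §2; skeleton `KT.coarseNoIntruder_of_explicit`, re-proved over the tree constants.) [cite: ReedSimonIV1978, XIII.1] [cite: Luscher1983] -/
theorem levelValue_le_of_explicitNoIntruder (k : ℕ) (h : ExplicitNoIntruder k) :
    ∀ d : ℝ, d < levelGap k → ∃ lam0 : ℝ, 0 < lam0 ∧ ∀ lam : ℝ, 0 < lam → lam ≤ lam0 →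
      ∃ L0 : ℕ, ∀ (L : ℕ) [NeZero L], L0 ≤ L → ∀ β : ℝ, InFemtoWindow lam β L →
        levelValue su2Rep L β k ≤ Real.exp (-(d * luscherLambda β L) / L) * levelValue su2Rep L β 0 := by
  refine levelValue_le_of_longTime k fun ε hε => ?_
  obtain ⟨M, hM, lam0, hlam0, H⟩ := h ε hε
  refine ⟨M, hM, lam0, hlam0, fun lam hlam hle => ?_⟩
  obtain ⟨L1, HL⟩ := H lam hlam hle
  refine ⟨L1, fun L _ hL1 β hw => ?_⟩
  obtain ⟨t, m, u, hC, Hn⟩ := HL L hL1 β hw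
  exact ⟨fun i => dressedLift β t m (u i), hC, Hn⟩

/-- **Glue, all levels (PROVED): `(∀ k, ExplicitNoIntruder k)` ⟹ KT's stub 3** — the conclusion is the VERBATIM body of `KT.CoarseNoIntruder`
(= `KTCoarseHandover.KTCoarseNoIntruder` = `KT.Derived.coarseNoIntruder` of «KTR» rev 3), so a re-pointed skeleton has
`theorem coarseNoIntruder_of_explicit' (h : Stmt.stub_explicitNoIntruder) : Derived.coarseNoIntruder := coarseNoIntruder_of_explicit h`.
[cite: ReedSimonIV1978, XIII.1] [cite: Luscher1983] -/
theorem coarseNoIntruder_of_explicit (h : ∀ k, ExplicitNoIntruder k) :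
    ∀ k : ℕ, ∀ d : ℝ, d < levelGap k → ∃ lam0 : ℝ, 0 < lam0 ∧ ∀ lam : ℝ, 0 < lam → lam ≤ lam0 →
      ∃ L0 : ℕ, ∀ (L : ℕ) [NeZero L], L0 ≤ L → ∀ β : ℝ, InFemtoWindow lam β L →
        levelValue su2Rep L β k ≤ Real.exp (-(d * luscherLambda β L) / L) * levelValue su2Rep L β 0 :=
  fun k => levelValue_le_of_explicitNoIntruder k (h k)

/-! ## §3 The degenerate instance `k = 0` (unconditional) -/

/-- `Δ_0 = 0`. [cite: Luscher1983, §1] -/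
theorem levelGap_zero : levelGap 0 = 0 := sub_self _

/-- **`ExplicitNoIntruder 0` holds UNCONDITIONALLY** (memo §5 degenerate-instance pass, kernel-checked): with no constraint and `Δ_0 = 0` the bound
reads `⟨ψ, K_β^n ψ⟩ ≤ e^{ε·nλ/L} λ_0^n ‖ψ‖²` for physical `ψ`, which follows from the ratio law `a_n ≤ λ_0^n a_0` (`transferMoment_le_pow_mul`, `β ≥ 1`
on the window) and `e^{ε·nλ/L} ≥ 1`.  Witnesses: `M = 1`, `lam0 = 1`, `L1 = 0`, `t = 0`, `m = 0`, no one-site functions.  So the fifth stub's shape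
is consistent and not vacuous at `k = 0`; its content starts at `k = 1`. [cite: ReedSimonIV1978, Thm. XIII.1] -/
theorem explicitNoIntruder_zero : ExplicitNoIntruder 0 := by
  intro ε hε
  refine ⟨1, one_pos, 1, one_pos, fun lam hlam _ => ⟨0, fun L _ _ β hw => ?_⟩⟩
  refine ⟨0, 0, Fin.elim0, fun i => Fin.elim0 i, ?_⟩
  intro n hlo _ ψ hψ _
  have hβ0 : 0 ≤ β := zero_le_one.trans hw.1
  have hτ : 0 ≤ (n : ℝ) * luscherLambda β L / L := le_trans zero_le_one hlo
  have hexp : 1 ≤ Real.exp (-((levelGap 0 - ε) * (n * luscherLambda β L / L))) := by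
    rw [Real.one_le_exp_iff, levelGap_zero, zero_sub, neg_mul, neg_neg]
    exact mul_nonneg hε.le hτ
  have hmain := transferMoment_le_pow_mul hβ0 hψ n
  rw [transferMoment, transferMoment_zero] at hmain
  have hnn : 0 ≤ levelValue su2Rep L β 0 ^ n * l2 ψ ψ :=
    mul_nonneg (pow_nonneg (levelValue_zero_su2Rep_pos L β).le _) (l2_self_nonneg _)
  calc l2 ψ ((transferApply β)^[n] ψ) ≤ levelValue su2Rep L β 0 ^ n * l2 ψ ψ := hmain
    _ = 1 * (levelValue su2Rep L β 0 ^ n * l2 ψ ψ) := (one_mul _).symm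
    _ ≤ Real.exp (-((levelGap 0 - ε) * (n * luscherLambda β L / L))) * (levelValue su2Rep L β 0 ^ n * l2 ψ ψ) :=
        mul_le_mul_of_nonneg_right hexp hnn
    _ = _ := by ring

end Summit.QuantumFields.YangMills.Theorems.FemtoTransferGap

end
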